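/-
Copyright (c) 2026 the pub-hodgecm-mathlib formalisation cell (harness21).  Prover seat hodgecm-mathlib-K2E4-p11 (g6), Track B ∕ K2-LIT, h413 = `stmt-HodgeConjecture-24833`,
line `K2_E1_TraceFormulaBeta`, campaign «5Res ENDGAME BY FAMILIES», ROADCARD §3′ D4′c (SD), dealer K2E1-plan (g7) deals (241)∕(250)∕(251) «(i) `K2E1ChiMaassSelbergRealPoleCMTwo` now»: the
χ-ROAD PLUMBING of the (MS-real) chain — from the `(χ, τ)` Maass–Selberg relation of a continued Hilbert family on an upper AND a lower quarter-domain near a real pole `c ∈ (½, 1]` to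
(MS-c) and the `L²`-RESIDUE `u = lim (z − c)•F(z)`.
-/
import Summits.HodgeConjecture.HodgeConjecture.Theorems.K2E1ChiMaassSelbergContinuedLowerCMTwo   -- ★ p860112 (K2E1-p15): `conj_fourTerm`, reflection pattern; brings ★ OnBoxes p859884 `diag_eq_fourBracket_of_pairing_on'`, ★ `pairing_of_differentiableOn`, ★ `differentiableOn_conj_comp_conj`
import Summits.HodgeConjecture.HodgeConjecture.Theorems.K2E1MaassSelbergRealPoleResidue           -- ★ p860558 (this seat): (MS-c) ∕ residue from the diagonal letter; brings ★ vector-α p860505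
import HarnessLib

/-!
# D4′c (SD) — `K2E1ChiMaassSelbergRealPoleCMTwo`: the `(χ, τ)` MAASS–SELBERG RELATION OF A CONTINUED HILBERT FAMILY ABOVE AND BELOW THE REAL AXIS NEAR A REAL POLE `c > ½` ⟹ (MS-c)
# `‖(z − c)•F z‖ ≤ C` AND THE RESIDUE `(z − c)•F z → u` (`U(1,1)` four-term, `ρ₀ = 1`; road currency of ★ `poleControl_continued_chi_cm_two_of_family[_lower]_on'`)

Track B ∕ K2-LIT, crux h413 = `stmt-HodgeConjecture-24833`, route of record `HCCMUnconditional`; cell `hodgecm-mathlib`, squad K2, ENGINE E1; dealer K2E1-plan (g7) (250)∕(251): «order (i) E1 plumbing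
`K2E1ChiMaassSelbergRealPoleCMTwo` THEN (ii) FILE C».  THEOREMS ONLY (no `def`, no `instance`, no `notation`, no named-fact hypothesis, no `sorry`); lane `--supports
stmt-HodgeConjecture-24833 --as helper` (count-neutral).  Closes no socket.

CURRENCY = ★ `poleControl_continued_chi_cm_two_of_family_on'` (★ p859884 §2) and its lower twin ★ `…_family_lower_on'` (★ p860112): a complex Hilbert space `H` (E1: `L²(X_U, μ)`), a family
`F : ℂ → H` (E1: `z ↦ [Λ^T E(φ, z)]` continued, ★ `exists_truncatedFamily_chi_cm_two[_upper]`), holomorphic on an UPPER quarter-domain `D₁ ⊆ D⁺ = {½ < Re, 0 < Im}` (open preconnected, with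
two sub-tube boxes `O₁, O₂′`, `1 < Re z′ < Re z` across) and on a LOWER one `D₂ ⊆ D⁻ = {½ < Re, Im < 0}` (boxes `O₃, O₄′`), the bracket letters `B₁ = a`, `B₂` (`w ↦ B₂ w̄` holomorphic on
`conj⁻¹Dᵢ`), `B₃` holomorphic with `B₃ = conj B₂` on `Dᵢ` (the `⟪M(z;χ)φ, φ⟫`-pairing), `B₄(·, z′)`∕`B₄(z, ·̄)` holomorphic with `B₄(z,z) = b z` (the `‖M(z;χ)φ‖²`-pairing), and the RELATION
`hrelᵢ : ⟪F z′, F z⟫ = R(z, z′; B)` on the sub-tube of `Dᵢ × Dᵢ` (★ `maassSelberg_chiSection_cm_two` ∕ K2E4-p14's bracket bridge at M1).  THE REAL POLE: `c > ½` with punctured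
neighbourhoods splitting into `D₁` (`Im > 0`) and `D₂` (`Im < 0`) (`hup`, `hlo`), `F` holomorphic on an open `V` containing a punctured neighbourhood of `c`, and the three scalar pole letters of
★ vector-α: `(z − c)·B₃ = d` analytic at `c` (`hd`, `hdw`), `B₃` real at the real points near `c` (`hreal` ⟸ `hadj`), `|z − c|²·b` bounded near `c` (`hb` ⟸ the operator's simple pole).
OUTPUT: **(MS-c)** `∃ C, ∀ᶠ z in 𝓝[≠] c, ‖(z − c)•F z‖ ≤ C` and the **RESIDUE** `∃ u, (z − c)•F z → u` — the `Res`∕`hRes` letters of the operator road at a real pole of the `χ`-block, and the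
input of the Gram road of ★ `K2E1ResidueOperatorLettersOfGram` (FILE C next).

THE MATHEMATICS ([MoeglinWaldspurger1995, IV.2.3, IV.3.12 (a), IV.1.11]; [Arthur1980TraceFormulaII, §4]; [Langlands1976, §7]).  On `D₁` the relation continues to the diagonal: `‖F z‖² =
R₁(z; a, B₃ z, b z)` (★ `diag_eq_fourBracket_of_pairing_on'` with ★ `pairing_of_differentiableOn`, then `B₁ = a`, `B₂ = conj B₃`, `B₄(z,z) = b z`); on `D₂` the same after REFLECTION
`u = z̄` (the reflected pairing `Φ(u,u′) = ⟪F ū, F ū′⟫` and reflected brackets live on `conj⁻¹D₂ ⊆ D⁺`; ★ `conj_fourTerm`), so `‖F z‖² ≤ |R₁(z; a, B₃ z, b z)|` off the real axis near `c`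
(§1 `normSq_eq_fourTerm_upper`, `normSq_eq_fourTerm_lower`, `eventually_normSq_le_fourTerm`).  ★ `K2E1MaassSelbergRealPoleResidue` (vector-α at the pole `c`, `ρ₀ = 1 < 2c`, continuity
onto the axis, Riemann) finishes (§2).
* §1 `normSq_eq_fourTerm_upper`, `normSq_eq_fourTerm_lower` (the two diagonal identities in the pairing currency `(a, B₃, b)`), `eventually_normSq_le_fourTerm` (the `hdiag` letter near `c`).
* §2 HEADS **`chi_ms_real_pole_bound_cm_two`** ((MS-c)) and **`exists_chi_L2Residue_real_pole_cm_two`** (the residue).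
HONEST LABEL: HC_CM is proved only modulo the 7 printed citations (2 remaining named inputs: hLiu418 = `stmt-HodgeConjecture-24832`, h413 = `stmt-HodgeConjecture-24833`) until rung 0
closes; this file asserts no named fact and closes no socket; count-neutral; unconditional (binder form — the remaining visible letters are `hrel₁∕hrel₂` (★ at the CM pair ∕ M1 bridge),
the three pole letters `hd∕hreal∕hb`, and the road's `F`, `D₁`, `D₂`, `V`).

## References
* [MoeglinWaldspurger1995] C. Mœglin, J.-L. Waldspurger, *Spectral decomposition and Eisenstein series* (1995), IV.1.11, IV.2.3, IV.3.12 (a).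
* [Arthur1980TraceFormulaII] J. Arthur, *A trace formula for reductive groups II*, Compositio Math. 40 (1980), §4.
* [Langlands1976] R. P. Langlands, *On the Functional Equations Satisfied by Eisenstein Series*, LNM 544 (1976), §7.
-/

set_option autoImplicit false
-- the mandated namespace repeats `HodgeConjecture.HodgeConjecture`, as in every `Theorems/*.lean` of this sub-problem
set_option linter.dupNamespace false

noncomputable section

open Set Filter Topology Metric
open scoped ComplexConjugate InnerProductSpace
open Summit.HodgeConjecture.HodgeConjecture.Cruxes.H413.K2E1MaassSelbergContinuedCMTwo (differentiableOn_conj_comp_conj)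
open Summit.HodgeConjecture.HodgeConjecture.Cruxes.H413.K2E1MaassSelbergPairingCMTwo (pairing_of_differentiableOn)
open Summit.HodgeConjecture.HodgeConjecture.Cruxes.H413.K2E1ChiMaassSelbergContinuedOnBoxesCMTwo (diag_eq_fourBracket_of_pairing_on')
open Summit.HodgeConjecture.HodgeConjecture.Cruxes.H413.K2E1ChiMaassSelbergContinuedModelsCMTwo (inner_self_eq_ofReal_norm_sq)
open Summit.HodgeConjecture.HodgeConjecture.Cruxes.H413.K2E1ChiMaassSelbergContinuedLowerCMTwo (conj_fourTerm isPreconnected_conj_preimage conj_preimage_conj_preimage)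
open Summit.HodgeConjecture.HodgeConjecture.Cruxes.H413.K2E1MaassSelbergRealPoleResidue (exists_eventually_norm_sub_smul_le_of_diag exists_tendsto_sub_smul_of_diag)

namespace Summit.HodgeConjecture.HodgeConjecture.Cruxes.H413.K2E1ChiMaassSelbergRealPoleCMTwo

variable {H : Type*} [NormedAddCommGroup H] [InnerProductSpace ℂ H]

/-! ## §1 The two diagonal identities in the pairing currency, and the `hdiag` letter near a real point -/

/-- **THE DIAGONAL IDENTITY ON AN UPPER QUARTER-DOMAIN, PAIRING CURRENCY**: under the letters of ★ `poleControl_continued_chi_cm_two_of_family_on'` (without the positivity∕Cauchy–Schwarz ones),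
`‖F z‖² = R₁(z; a, B₃ z, b z)` for every `z ∈ D₁`. [cite: MoeglinWaldspurger1995, IV.2.3] -/
theorem normSq_eq_fourTerm_upper {D₁ : Set ℂ} (hD₁ : IsOpen D₁) (hD₁c : IsPreconnected D₁) (hD₁sub : D₁ ⊆ {z : ℂ | 1 / 2 < z.re ∧ 0 < z.im})
    {O₁ O₂' : Set ℂ} (hO₁ : IsOpen O₁) (hO₁ne : O₁.Nonempty) (hO₁D : O₁ ⊆ D₁) (hO₂' : IsOpen O₂') (hO₂'ne : O₂'.Nonempty) (hO₂'D : O₂' ⊆ D₁)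
    (hsep : ∀ z ∈ O₁, ∀ z' ∈ O₂', 1 < z'.re ∧ z'.re < z.re)
    {T cμ K : ℝ} (hT : 0 < T) {a : ℝ} {b : ℂ → ℝ}
    {B₁ : ℂ} {B₂ B₃ : ℂ → ℂ} {B₄ : ℂ → ℂ → ℂ} (hB₁ : B₁ = ((a : ℝ) : ℂ)) (hB₂ : DifferentiableOn ℂ (fun w : ℂ => B₂ (conj w)) {w : ℂ | conj w ∈ D₁}) (hB₃ : DifferentiableOn ℂ B₃ D₁)
    (hB₃₂ : ∀ z ∈ D₁, B₃ z = conj (B₂ z)) (hB₄₁ : ∀ z' ∈ D₁, DifferentiableOn ℂ (fun z : ℂ => B₄ z z') D₁)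
    (hB₄₂ : ∀ z ∈ D₁, DifferentiableOn ℂ (fun w : ℂ => B₄ z (conj w)) {w : ℂ | conj w ∈ D₁}) (hB₄d : ∀ z ∈ D₁, B₄ z z = ((b z : ℝ) : ℂ))
    (F : ℂ → H) (hFd : DifferentiableOn ℂ F D₁)
    (hrel : ∀ z ∈ D₁, ∀ z' ∈ D₁, 1 < z'.re → z'.re < z.re →
      ⟪F z', F z⟫_ℂ = ((cμ : ℝ) : ℂ) * (((K : ℝ) : ℂ) *
        ((((T : ℝ) : ℂ) ^ (z + conj z' - 1) / (z + conj z' - 1)) * B₁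
          + (((T : ℝ) : ℂ) ^ (z - conj z') / (z - conj z')) * B₂ z'
          - (((T : ℝ) : ℂ) ^ (-(z - conj z')) / (z - conj z')) * B₃ z
          - (((T : ℝ) : ℂ) ^ (-(z + conj z' - 1)) / (z + conj z' - 1)) * B₄ z z')))
    {z : ℂ} (hz : z ∈ D₁) :
    (((‖F z‖ ^ 2 : ℝ)) : ℂ) = ((cμ : ℝ) : ℂ) * (((K : ℝ) : ℂ) *
        ((((T : ℝ) : ℂ) ^ (z + conj z - 1) / (z + conj z - 1)) * ((a : ℝ) : ℂ)
          + (((T : ℝ) : ℂ) ^ (z - conj z) / (z - conj z)) * conj (B₃ z)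
          - (((T : ℝ) : ℂ) ^ (-(z - conj z)) / (z - conj z)) * B₃ z
          - (((T : ℝ) : ℂ) ^ (-(z + conj z - 1)) / (z + conj z - 1)) * ((b z : ℝ) : ℂ))) := by
  obtain ⟨hΦ₁, hΦ₂, hQ⟩ := pairing_of_differentiableOn hD₁ hFd
  have hdiag := diag_eq_fourBracket_of_pairing_on' hD₁ hD₁c hD₁sub hO₁ hO₁ne hO₁D hO₂' hO₂'ne hO₂'D hsep hT (cμ := cμ) (K := K) hB₂ hB₃ hB₄₁ hB₄₂
    (Φ := fun z z' => ⟪F z', F z⟫_ℂ) hΦ₁ hΦ₂ hrel hz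
  have hB₂z : B₂ z = conj (B₃ z) := by rw [hB₃₂ z hz, Complex.conj_conj]
  rw [(hQ z hz).2, hB₁, hB₂z, hB₄d z hz] at hdiag
  exact hdiag

/-- **THE DIAGONAL IDENTITY ON A LOWER QUARTER-DOMAIN, PAIRING CURRENCY** (by reflection through ★ p860112's pattern: the reflected pairing `Φ(u,u′) = ⟪F ū, F ū′⟫` and brackets on `conj⁻¹D₂ ⊆ D⁺`,
★ `conj_fourTerm`): `‖F z‖² = R₁(z; a, B₃ z, b z)` for every `z ∈ D₂ ⊆ D⁻`. [cite: MoeglinWaldspurger1995, IV.2.3] -/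
theorem normSq_eq_fourTerm_lower {D₂ : Set ℂ} (hD₂ : IsOpen D₂) (hD₂c : IsPreconnected D₂) (hD₂sub : D₂ ⊆ {z : ℂ | 1 / 2 < z.re ∧ z.im < 0})
    {O₃ O₄' : Set ℂ} (hO₃ : IsOpen O₃) (hO₃ne : O₃.Nonempty) (hO₃D : O₃ ⊆ D₂) (hO₄' : IsOpen O₄') (hO₄'ne : O₄'.Nonempty) (hO₄'D : O₄' ⊆ D₂)
    (hsep : ∀ z ∈ O₃, ∀ z' ∈ O₄', 1 < z'.re ∧ z'.re < z.re)
    {T cμ K : ℝ} (hT : 0 < T) {a : ℝ} {b : ℂ → ℝ}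
    {B₁ : ℂ} {B₂ B₃ : ℂ → ℂ} {B₄ : ℂ → ℂ → ℂ} (hB₁ : B₁ = ((a : ℝ) : ℂ)) (hB₂ : DifferentiableOn ℂ (fun w : ℂ => B₂ (conj w)) {w : ℂ | conj w ∈ D₂}) (hB₃ : DifferentiableOn ℂ B₃ D₂)
    (hB₃₂ : ∀ z ∈ D₂, B₃ z = conj (B₂ z)) (hB₄₁ : ∀ z' ∈ D₂, DifferentiableOn ℂ (fun z : ℂ => B₄ z z') D₂)
    (hB₄₂ : ∀ z ∈ D₂, DifferentiableOn ℂ (fun w : ℂ => B₄ z (conj w)) {w : ℂ | conj w ∈ D₂}) (hB₄d : ∀ z ∈ D₂, B₄ z z = ((b z : ℝ) : ℂ))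
    (F : ℂ → H) (hFd : DifferentiableOn ℂ F D₂)
    (hrel : ∀ z ∈ D₂, ∀ z' ∈ D₂, 1 < z'.re → z'.re < z.re →
      ⟪F z', F z⟫_ℂ = ((cμ : ℝ) : ℂ) * (((K : ℝ) : ℂ) *
        ((((T : ℝ) : ℂ) ^ (z + conj z' - 1) / (z + conj z' - 1)) * B₁
          + (((T : ℝ) : ℂ) ^ (z - conj z') / (z - conj z')) * B₂ z'
          - (((T : ℝ) : ℂ) ^ (-(z - conj z')) / (z - conj z')) * B₃ z
          - (((T : ℝ) : ℂ) ^ (-(z + conj z' - 1)) / (z + conj z' - 1)) * B₄ z z')))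
    {z : ℂ} (hz : z ∈ D₂) :
    (((‖F z‖ ^ 2 : ℝ)) : ℂ) = ((cμ : ℝ) : ℂ) * (((K : ℝ) : ℂ) *
        ((((T : ℝ) : ℂ) ^ (z + conj z - 1) / (z + conj z - 1)) * ((a : ℝ) : ℂ)
          + (((T : ℝ) : ℂ) ^ (z - conj z) / (z - conj z)) * conj (B₃ z)
          - (((T : ℝ) : ℂ) ^ (-(z - conj z)) / (z - conj z)) * B₃ z
          - (((T : ℝ) : ℂ) ^ (-(z + conj z - 1)) / (z + conj z - 1)) * ((b z : ℝ) : ℂ))) := by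
  -- the reflected domain `D = conj⁻¹ D₂ ⊆ D⁺` and boxes
  have hDo : IsOpen {u : ℂ | conj u ∈ D₂} := hD₂.preimage Complex.continuous_conj
  have hDc : IsPreconnected {u : ℂ | conj u ∈ D₂} := isPreconnected_conj_preimage hD₂c
  have hDsub : {u : ℂ | conj u ∈ D₂} ⊆ {z : ℂ | 1 / 2 < z.re ∧ 0 < z.im} := by
    intro u hu
    obtain ⟨h1, h2⟩ := hD₂sub hu
    rw [Complex.conj_re] at h1
    rw [Complex.conj_im] at h2
    exact ⟨h1, by linarith⟩
  have hPo : IsOpen {u : ℂ | conj u ∈ O₃} := hO₃.preimage Complex.continuous_conj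
  have hPne : ({u : ℂ | conj u ∈ O₃}).Nonempty := by
    obtain ⟨w, hw⟩ := hO₃ne; exact ⟨conj w, by simpa only [Set.mem_setOf_eq, Complex.conj_conj] using hw⟩
  have hPD : {u : ℂ | conj u ∈ O₃} ⊆ {u : ℂ | conj u ∈ D₂} := fun u hu => hO₃D hu
  have hP'o : IsOpen {u : ℂ | conj u ∈ O₄'} := hO₄'.preimage Complex.continuous_conj
  have hP'ne : ({u : ℂ | conj u ∈ O₄'}).Nonempty := by
    obtain ⟨w, hw⟩ := hO₄'ne; exact ⟨conj w, by simpa only [Set.mem_setOf_eq, Complex.conj_conj] using hw⟩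
  have hP'D : {u : ℂ | conj u ∈ O₄'} ⊆ {u : ℂ | conj u ∈ D₂} := fun u hu => hO₄'D hu
  have hsep' : ∀ u ∈ {u : ℂ | conj u ∈ O₃}, ∀ u' ∈ {u : ℂ | conj u ∈ O₄'}, 1 < u'.re ∧ u'.re < u.re := by
    intro u hu u' hu'
    have h := hsep (conj u) hu (conj u') hu'
    simp only [Complex.conj_re] at h
    exact h
  -- the reflected bracket letters
  have hB₂' : DifferentiableOn ℂ (fun w : ℂ => conj (B₂ (conj (conj w)))) {w : ℂ | conj w ∈ {u : ℂ | conj u ∈ D₂}} :=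
    differentiableOn_conj_comp_conj hDo hB₂
  have hB₃' : DifferentiableOn ℂ (fun u : ℂ => conj (B₃ (conj u))) {u : ℂ | conj u ∈ D₂} := differentiableOn_conj_comp_conj hD₂ hB₃
  have hB₄₁' : ∀ u' ∈ {u : ℂ | conj u ∈ D₂}, DifferentiableOn ℂ (fun u : ℂ => conj (B₄ (conj u) (conj u'))) {u : ℂ | conj u ∈ D₂} :=
    fun u' hu' => differentiableOn_conj_comp_conj hD₂ (hB₄₁ (conj u') hu')
  have hB₄₂' : ∀ u ∈ {u : ℂ | conj u ∈ D₂}, DifferentiableOn ℂ (fun w : ℂ => conj (B₄ (conj u) (conj (conj w)))) {w : ℂ | conj w ∈ {u : ℂ | conj u ∈ D₂}} :=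
    fun u hu => differentiableOn_conj_comp_conj hDo (hB₄₂ (conj u) hu)
  -- the reflected pairing `Φ(u, u') = ⟪F ū, F ū'⟫`
  have hΦ₁ : ∀ u' ∈ {u : ℂ | conj u ∈ D₂}, DifferentiableOn ℂ (fun u : ℂ => ⟪F (conj u), F (conj u')⟫_ℂ) {u : ℂ | conj u ∈ D₂} := by
    intro u' _
    have h := differentiableOn_conj_comp_conj hD₂ ((innerSL ℂ (F (conj u'))).differentiable.comp_differentiableOn hFd)
    refine h.congr fun u _ => ?_
    show ⟪F (conj u), F (conj u')⟫_ℂ = conj ⟪F (conj u'), F (conj u)⟫_ℂ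
    exact (inner_conj_symm _ _).symm
  have hΦ₂ : ∀ u ∈ {u : ℂ | conj u ∈ D₂}, DifferentiableOn ℂ (fun w : ℂ => ⟪F (conj u), F (conj (conj w))⟫_ℂ) {w : ℂ | conj w ∈ {u : ℂ | conj u ∈ D₂}} := by
    intro u _
    rw [conj_preimage_conj_preimage]
    exact ((innerSL ℂ (F (conj u))).differentiable.comp_differentiableOn hFd).congr fun w _ => by simp only [Complex.conj_conj]; rfl
  have hrel' : ∀ u ∈ {u : ℂ | conj u ∈ D₂}, ∀ u' ∈ {u : ℂ | conj u ∈ D₂}, 1 < u'.re → u'.re < u.re →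
      ⟪F (conj u), F (conj u')⟫_ℂ = ((cμ : ℝ) : ℂ) * (((K : ℝ) : ℂ) *
        ((((T : ℝ) : ℂ) ^ (u + conj u' - 1) / (u + conj u' - 1)) * conj B₁
          + (((T : ℝ) : ℂ) ^ (u - conj u') / (u - conj u')) * conj (B₂ (conj u'))
          - (((T : ℝ) : ℂ) ^ (-(u - conj u')) / (u - conj u')) * conj (B₃ (conj u))
          - (((T : ℝ) : ℂ) ^ (-(u + conj u' - 1)) / (u + conj u' - 1)) * conj (B₄ (conj u) (conj u')))) := by
    intro u hu u' hu' h1 h2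
    have h := hrel (conj u) hu (conj u') hu' (by rwa [Complex.conj_re]) (by simpa only [Complex.conj_re] using h2)
    rw [← inner_conj_symm, h, conj_fourTerm hT]
  -- the D⁺ diagonal identity at `u = conj z`
  have hzD : conj z ∈ {u : ℂ | conj u ∈ D₂} := by simpa only [Set.mem_setOf_eq, Complex.conj_conj] using hz
  have hmain := diag_eq_fourBracket_of_pairing_on' hDo hDc hDsub hPo hPne hPD hP'o hP'ne hP'D hsep' hT (cμ := cμ) (K := K)
    (B₁ := conj B₁) (B₂ := fun u' => conj (B₂ (conj u'))) (B₃ := fun u => conj (B₃ (conj u))) (B₄ := fun u u' => conj (B₄ (conj u) (conj u')))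
    hB₂' hB₃' hB₄₁' hB₄₂' (Φ := fun u u' => ⟪F (conj u), F (conj u')⟫_ℂ) hΦ₁ hΦ₂ hrel' hzD
  -- unfold the reflection at `u = conj z`
  simp only [Complex.conj_conj] at hmain
  rw [inner_self_eq_ofReal_norm_sq] at hmain
  have e3 : -(conj z - z) = z - conj z := by ring
  have e1 : conj z + z - 1 = z + conj z - 1 := by ring
  have e2 : conj z - z = -(z - conj z) := by ring
  rw [hB₁, Complex.conj_ofReal, ← hB₃₂ z hz, hB₄d z hz, Complex.conj_ofReal, e3, e1, e2] at hmain
  rw [hmain]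
  simp only [div_neg]
  ring

omit [InnerProductSpace ℂ H] in
/-- **THE `hdiag` LETTER NEAR A REAL POINT**: if the punctured neighbourhoods of a real `c` split into an upper domain `D₁` (`Im > 0`) and a lower one `D₂` (`Im < 0`) on which the two diagonal
identities hold, then `‖F z‖² ≤ |R₁(z; a, B₃ z, b z)|` off the real axis near `c`. [cite: MoeglinWaldspurger1995, IV.2.3] -/
theorem eventually_normSq_le_fourTerm {T cμ K : ℝ} {a : ℝ} {b : ℂ → ℝ} {B₃ : ℂ → ℂ} (F : ℂ → H) {D₁ D₂ : Set ℂ} {c : ℝ}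
    (h₁ : ∀ z ∈ D₁, (((‖F z‖ ^ 2 : ℝ)) : ℂ) = ((cμ : ℝ) : ℂ) * (((K : ℝ) : ℂ) *
        ((((T : ℝ) : ℂ) ^ (z + conj z - 1) / (z + conj z - 1)) * ((a : ℝ) : ℂ)
          + (((T : ℝ) : ℂ) ^ (z - conj z) / (z - conj z)) * conj (B₃ z)
          - (((T : ℝ) : ℂ) ^ (-(z - conj z)) / (z - conj z)) * B₃ z
          - (((T : ℝ) : ℂ) ^ (-(z + conj z - 1)) / (z + conj z - 1)) * ((b z : ℝ) : ℂ))))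
    (h₂ : ∀ z ∈ D₂, (((‖F z‖ ^ 2 : ℝ)) : ℂ) = ((cμ : ℝ) : ℂ) * (((K : ℝ) : ℂ) *
        ((((T : ℝ) : ℂ) ^ (z + conj z - 1) / (z + conj z - 1)) * ((a : ℝ) : ℂ)
          + (((T : ℝ) : ℂ) ^ (z - conj z) / (z - conj z)) * conj (B₃ z)
          - (((T : ℝ) : ℂ) ^ (-(z - conj z)) / (z - conj z)) * B₃ z
          - (((T : ℝ) : ℂ) ^ (-(z + conj z - 1)) / (z + conj z - 1)) * ((b z : ℝ) : ℂ))))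
    (hup : ∀ᶠ z : ℂ in 𝓝[≠] (c : ℂ), 0 < z.im → z ∈ D₁) (hlo : ∀ᶠ z : ℂ in 𝓝[≠] (c : ℂ), z.im < 0 → z ∈ D₂) :
    ∀ᶠ z : ℂ in 𝓝[≠] (c : ℂ), z.im ≠ 0 → ‖F z‖ ^ 2 ≤
      ‖((cμ : ℝ) : ℂ) * (((K : ℝ) : ℂ) *
        ((((T : ℝ) : ℂ) ^ (z + conj z - 1) / (z + conj z - 1)) * ((a : ℝ) : ℂ)
          + (((T : ℝ) : ℂ) ^ (z - conj z) / (z - conj z)) * conj (B₃ z)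
          - (((T : ℝ) : ℂ) ^ (-(z - conj z)) / (z - conj z)) * B₃ z
          - (((T : ℝ) : ℂ) ^ (-(z + conj z - 1)) / (z + conj z - 1)) * ((b z : ℝ) : ℂ)))‖ := by
  filter_upwards [hup, hlo] with z hzu hzl hzim
  have key : ∀ {w : ℂ}, (((‖F z‖ ^ 2 : ℝ)) : ℂ) = w → ‖F z‖ ^ 2 ≤ ‖w‖ := fun {w} hw => by
    rw [← hw, Complex.norm_real, Real.norm_eq_abs, abs_of_nonneg (sq_nonneg _)]
  rcases lt_or_gt_of_ne hzim with hlt | hgt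
  · exact key (h₂ z (hzl hlt))
  · exact key (h₁ z (hzu hgt))

/-! ## §2 HEADS: (MS-c) and the residue at a real pole `c > ½` -/

section Heads

/-- **(MS-c) FOR THE CONTINUED `χ`-FAMILY AT A REAL POLE `c > ½`** (road currency, both quarter-domains): `∃ C, ∀ᶠ z in 𝓝[≠] c, ‖(z − c)•F z‖ ≤ C`.  Letters: the `(χ,τ)` relation on the sub-tubes
of `D₁ ⊆ D⁺` and `D₂ ⊆ D⁻` with the bracket regularity of ★ `poleControl_continued_chi_cm_two_of_family[_lower]_on'`; the pole letters `hd`∕`hdw` (`(z−c)·B₃` analytic at `c`), `hreal`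
(`B₃` real at real points near `c`), `hb` (`|z−c|²·b` bounded); `F` continuous on an open `V ⊇` punctured neighbourhood of `c` which splits into `D₁`∕`D₂` off the axis.
[cite: MoeglinWaldspurger1995, IV.2.3, IV.3.12 (a)] [cite: Arthur1980TraceFormulaII, §4] -/
theorem chi_ms_real_pole_bound_cm_two
    {D₁ : Set ℂ} (hD₁ : IsOpen D₁) (hD₁c : IsPreconnected D₁) (hD₁sub : D₁ ⊆ {z : ℂ | 1 / 2 < z.re ∧ 0 < z.im})
    {O₁ O₂' : Set ℂ} (hO₁ : IsOpen O₁) (hO₁ne : O₁.Nonempty) (hO₁D : O₁ ⊆ D₁) (hO₂' : IsOpen O₂') (hO₂'ne : O₂'.Nonempty) (hO₂'D : O₂' ⊆ D₁)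
    (hsep₁ : ∀ z ∈ O₁, ∀ z' ∈ O₂', 1 < z'.re ∧ z'.re < z.re)
    {D₂ : Set ℂ} (hD₂ : IsOpen D₂) (hD₂c : IsPreconnected D₂) (hD₂sub : D₂ ⊆ {z : ℂ | 1 / 2 < z.re ∧ z.im < 0})
    {O₃ O₄' : Set ℂ} (hO₃ : IsOpen O₃) (hO₃ne : O₃.Nonempty) (hO₃D : O₃ ⊆ D₂) (hO₄' : IsOpen O₄') (hO₄'ne : O₄'.Nonempty) (hO₄'D : O₄' ⊆ D₂)
    (hsep₂ : ∀ z ∈ O₃, ∀ z' ∈ O₄', 1 < z'.re ∧ z'.re < z.re)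
    {T cμ K : ℝ} (hT : 0 < T) {a : ℝ} {b : ℂ → ℝ} {B₁ : ℂ} {B₂ B₃ : ℂ → ℂ} {B₄ : ℂ → ℂ → ℂ} (hB₁ : B₁ = ((a : ℝ) : ℂ))
    (hB₂₁ : DifferentiableOn ℂ (fun w : ℂ => B₂ (conj w)) {w : ℂ | conj w ∈ D₁}) (hB₃₁ : DifferentiableOn ℂ B₃ D₁) (hB₃₂₁ : ∀ z ∈ D₁, B₃ z = conj (B₂ z))
    (hB₄₁₁ : ∀ z' ∈ D₁, DifferentiableOn ℂ (fun z : ℂ => B₄ z z') D₁) (hB₄₂₁ : ∀ z ∈ D₁, DifferentiableOn ℂ (fun w : ℂ => B₄ z (conj w)) {w : ℂ | conj w ∈ D₁})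
    (hB₄d₁ : ∀ z ∈ D₁, B₄ z z = ((b z : ℝ) : ℂ))
    (hB₂₂ : DifferentiableOn ℂ (fun w : ℂ => B₂ (conj w)) {w : ℂ | conj w ∈ D₂}) (hB₃₃ : DifferentiableOn ℂ B₃ D₂) (hB₃₂₂ : ∀ z ∈ D₂, B₃ z = conj (B₂ z))
    (hB₄₁₂ : ∀ z' ∈ D₂, DifferentiableOn ℂ (fun z : ℂ => B₄ z z') D₂) (hB₄₂₂ : ∀ z ∈ D₂, DifferentiableOn ℂ (fun w : ℂ => B₄ z (conj w)) {w : ℂ | conj w ∈ D₂})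
    (hB₄d₂ : ∀ z ∈ D₂, B₄ z z = ((b z : ℝ) : ℂ))
    (F : ℂ → H) (hFd₁ : DifferentiableOn ℂ F D₁) (hFd₂ : DifferentiableOn ℂ F D₂)
    (hrel₁ : ∀ z ∈ D₁, ∀ z' ∈ D₁, 1 < z'.re → z'.re < z.re →
      ⟪F z', F z⟫_ℂ = ((cμ : ℝ) : ℂ) * (((K : ℝ) : ℂ) *
        ((((T : ℝ) : ℂ) ^ (z + conj z' - 1) / (z + conj z' - 1)) * B₁
          + (((T : ℝ) : ℂ) ^ (z - conj z') / (z - conj z')) * B₂ z'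
          - (((T : ℝ) : ℂ) ^ (-(z - conj z')) / (z - conj z')) * B₃ z
          - (((T : ℝ) : ℂ) ^ (-(z + conj z' - 1)) / (z + conj z' - 1)) * B₄ z z')))
    (hrel₂ : ∀ z ∈ D₂, ∀ z' ∈ D₂, 1 < z'.re → z'.re < z.re →
      ⟪F z', F z⟫_ℂ = ((cμ : ℝ) : ℂ) * (((K : ℝ) : ℂ) *
        ((((T : ℝ) : ℂ) ^ (z + conj z' - 1) / (z + conj z' - 1)) * B₁
          + (((T : ℝ) : ℂ) ^ (z - conj z') / (z - conj z')) * B₂ z'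
          - (((T : ℝ) : ℂ) ^ (-(z - conj z')) / (z - conj z')) * B₃ z
          - (((T : ℝ) : ℂ) ^ (-(z + conj z' - 1)) / (z + conj z' - 1)) * B₄ z z')))
    {c : ℝ} (hc : 1 / 2 < c) {d : ℂ → ℂ} (hd : AnalyticAt ℂ d c) (hdw : ∀ᶠ z : ℂ in 𝓝[≠] (c : ℂ), d z = (z - c) * B₃ z)
    (hreal : ∀ᶠ x : ℝ in 𝓝[≠] c, (B₃ (x : ℂ)).im = 0) (hb : ∃ Mb : ℝ, ∀ᶠ z : ℂ in 𝓝[≠] (c : ℂ), ‖z - (c : ℂ)‖ ^ 2 * |b z| ≤ Mb)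
    {V : Set ℂ} (hV : IsOpen V) (hFc : ContinuousOn F V) (hmem : ∀ᶠ z : ℂ in 𝓝[≠] (c : ℂ), z ∈ V)
    (hup : ∀ᶠ z : ℂ in 𝓝[≠] (c : ℂ), 0 < z.im → z ∈ D₁) (hlo : ∀ᶠ z : ℂ in 𝓝[≠] (c : ℂ), z.im < 0 → z ∈ D₂) :
    ∃ C : ℝ, ∀ᶠ z : ℂ in 𝓝[≠] (c : ℂ), ‖(z - c) • F z‖ ≤ C := by
  have h₁ := fun (z : ℂ) (hz : z ∈ D₁) => normSq_eq_fourTerm_upper hD₁ hD₁c hD₁sub hO₁ hO₁ne hO₁D hO₂' hO₂'ne hO₂'D hsep₁ hT hB₁ hB₂₁ hB₃₁ hB₃₂₁ hB₄₁₁ hB₄₂₁ hB₄d₁ F hFd₁ hrel₁ hz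
  have h₂ := fun (z : ℂ) (hz : z ∈ D₂) => normSq_eq_fourTerm_lower hD₂ hD₂c hD₂sub hO₃ hO₃ne hO₃D hO₄' hO₄'ne hO₄'D hsep₂ hT hB₁ hB₂₂ hB₃₃ hB₃₂₂ hB₄₁₂ hB₄₂₂ hB₄d₂ F hFd₂ hrel₂ hz
  have hdiag := eventually_normSq_le_fourTerm F h₁ h₂ hup hlo
  exact exists_eventually_norm_sub_smul_le_of_diag cμ K hT a (ρ₀ := 1) (by rw [Complex.one_re]; linarith) hd hdw hreal hb F hV hFc hmem hdiag

/-- **THE `L²`-RESIDUE OF THE CONTINUED `χ`-FAMILY AT A REAL POLE `c > ½`** (road currency, both quarter-domains): `∃ u, (z − c)•F z → u` (`z → c`, `z ≠ c`) — the `Res`∕`hRes` letters of the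
operator road for the `χ`-block, and the input of the Gram road of ★ `K2E1ResidueOperatorLettersOfGram`.  Letters as (MS-c), with `F` holomorphic on the open `V`.
[cite: MoeglinWaldspurger1995, IV.1.11, IV.3.12 (a)] [cite: Langlands1976, §7] -/
theorem exists_chi_L2Residue_real_pole_cm_two [CompleteSpace H]
    {D₁ : Set ℂ} (hD₁ : IsOpen D₁) (hD₁c : IsPreconnected D₁) (hD₁sub : D₁ ⊆ {z : ℂ | 1 / 2 < z.re ∧ 0 < z.im})
    {O₁ O₂' : Set ℂ} (hO₁ : IsOpen O₁) (hO₁ne : O₁.Nonempty) (hO₁D : O₁ ⊆ D₁) (hO₂' : IsOpen O₂') (hO₂'ne : O₂'.Nonempty) (hO₂'D : O₂' ⊆ D₁)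
    (hsep₁ : ∀ z ∈ O₁, ∀ z' ∈ O₂', 1 < z'.re ∧ z'.re < z.re)
    {D₂ : Set ℂ} (hD₂ : IsOpen D₂) (hD₂c : IsPreconnected D₂) (hD₂sub : D₂ ⊆ {z : ℂ | 1 / 2 < z.re ∧ z.im < 0})
    {O₃ O₄' : Set ℂ} (hO₃ : IsOpen O₃) (hO₃ne : O₃.Nonempty) (hO₃D : O₃ ⊆ D₂) (hO₄' : IsOpen O₄') (hO₄'ne : O₄'.Nonempty) (hO₄'D : O₄' ⊆ D₂)
    (hsep₂ : ∀ z ∈ O₃, ∀ z' ∈ O₄', 1 < z'.re ∧ z'.re < z.re)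
    {T cμ K : ℝ} (hT : 0 < T) {a : ℝ} {b : ℂ → ℝ} {B₁ : ℂ} {B₂ B₃ : ℂ → ℂ} {B₄ : ℂ → ℂ → ℂ} (hB₁ : B₁ = ((a : ℝ) : ℂ))
    (hB₂₁ : DifferentiableOn ℂ (fun w : ℂ => B₂ (conj w)) {w : ℂ | conj w ∈ D₁}) (hB₃₁ : DifferentiableOn ℂ B₃ D₁) (hB₃₂₁ : ∀ z ∈ D₁, B₃ z = conj (B₂ z))
    (hB₄₁₁ : ∀ z' ∈ D₁, DifferentiableOn ℂ (fun z : ℂ => B₄ z z') D₁) (hB₄₂₁ : ∀ z ∈ D₁, DifferentiableOn ℂ (fun w : ℂ => B₄ z (conj w)) {w : ℂ | conj w ∈ D₁})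
    (hB₄d₁ : ∀ z ∈ D₁, B₄ z z = ((b z : ℝ) : ℂ))
    (hB₂₂ : DifferentiableOn ℂ (fun w : ℂ => B₂ (conj w)) {w : ℂ | conj w ∈ D₂}) (hB₃₃ : DifferentiableOn ℂ B₃ D₂) (hB₃₂₂ : ∀ z ∈ D₂, B₃ z = conj (B₂ z))
    (hB₄₁₂ : ∀ z' ∈ D₂, DifferentiableOn ℂ (fun z : ℂ => B₄ z z') D₂) (hB₄₂₂ : ∀ z ∈ D₂, DifferentiableOn ℂ (fun w : ℂ => B₄ z (conj w)) {w : ℂ | conj w ∈ D₂})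
    (hB₄d₂ : ∀ z ∈ D₂, B₄ z z = ((b z : ℝ) : ℂ))
    (F : ℂ → H) (hFd₁ : DifferentiableOn ℂ F D₁) (hFd₂ : DifferentiableOn ℂ F D₂)
    (hrel₁ : ∀ z ∈ D₁, ∀ z' ∈ D₁, 1 < z'.re → z'.re < z.re →
      ⟪F z', F z⟫_ℂ = ((cμ : ℝ) : ℂ) * (((K : ℝ) : ℂ) *
        ((((T : ℝ) : ℂ) ^ (z + conj z' - 1) / (z + conj z' - 1)) * B₁
          + (((T : ℝ) : ℂ) ^ (z - conj z') / (z - conj z')) * B₂ z'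
          - (((T : ℝ) : ℂ) ^ (-(z - conj z')) / (z - conj z')) * B₃ z
          - (((T : ℝ) : ℂ) ^ (-(z + conj z' - 1)) / (z + conj z' - 1)) * B₄ z z')))
    (hrel₂ : ∀ z ∈ D₂, ∀ z' ∈ D₂, 1 < z'.re → z'.re < z.re →
      ⟪F z', F z⟫_ℂ = ((cμ : ℝ) : ℂ) * (((K : ℝ) : ℂ) *
        ((((T : ℝ) : ℂ) ^ (z + conj z' - 1) / (z + conj z' - 1)) * B₁
          + (((T : ℝ) : ℂ) ^ (z - conj z') / (z - conj z')) * B₂ z'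
          - (((T : ℝ) : ℂ) ^ (-(z - conj z')) / (z - conj z')) * B₃ z
          - (((T : ℝ) : ℂ) ^ (-(z + conj z' - 1)) / (z + conj z' - 1)) * B₄ z z')))
    {c : ℝ} (hc : 1 / 2 < c) {d : ℂ → ℂ} (hd : AnalyticAt ℂ d c) (hdw : ∀ᶠ z : ℂ in 𝓝[≠] (c : ℂ), d z = (z - c) * B₃ z)
    (hreal : ∀ᶠ x : ℝ in 𝓝[≠] c, (B₃ (x : ℂ)).im = 0) (hb : ∃ Mb : ℝ, ∀ᶠ z : ℂ in 𝓝[≠] (c : ℂ), ‖z - (c : ℂ)‖ ^ 2 * |b z| ≤ Mb)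
    {V : Set ℂ} (hV : IsOpen V) (hFdV : DifferentiableOn ℂ F V) (hmem : ∀ᶠ z : ℂ in 𝓝[≠] (c : ℂ), z ∈ V)
    (hup : ∀ᶠ z : ℂ in 𝓝[≠] (c : ℂ), 0 < z.im → z ∈ D₁) (hlo : ∀ᶠ z : ℂ in 𝓝[≠] (c : ℂ), z.im < 0 → z ∈ D₂) :
    ∃ u : H, Tendsto (fun z : ℂ => (z - c) • F z) (𝓝[≠] (c : ℂ)) (𝓝 u) := by
  have h₁ := fun (z : ℂ) (hz : z ∈ D₁) => normSq_eq_fourTerm_upper hD₁ hD₁c hD₁sub hO₁ hO₁ne hO₁D hO₂' hO₂'ne hO₂'D hsep₁ hT hB₁ hB₂₁ hB₃₁ hB₃₂₁ hB₄₁₁ hB₄₂₁ hB₄d₁ F hFd₁ hrel₁ hz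
  have h₂ := fun (z : ℂ) (hz : z ∈ D₂) => normSq_eq_fourTerm_lower hD₂ hD₂c hD₂sub hO₃ hO₃ne hO₃D hO₄' hO₄'ne hO₄'D hsep₂ hT hB₁ hB₂₂ hB₃₃ hB₃₂₂ hB₄₁₂ hB₄₂₂ hB₄d₂ F hFd₂ hrel₂ hz
  have hdiag := eventually_normSq_le_fourTerm F h₁ h₂ hup hlo
  exact exists_tendsto_sub_smul_of_diag cμ K hT a (ρ₀ := 1) (by rw [Complex.one_re]; linarith) hd hdw hreal hb F hV hFdV hmem hdiag

end Heads

end Summit.HodgeConjecture.HodgeConjecture.Cruxes.H413.K2E1ChiMaassSelbergRealPoleCMTwo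

end
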